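import Literature.Analysis.FluidPDE.CollisionalTransfer
import Literature.Analysis.FluidPDE.HardSphereCollisionRecord
import Literature.Analysis.FluidPDE.HardSphereRegularGeometry
import Literature.Analysis.FluidPDE.HardSphereTrajectoryMeasurable
import Literature.Analysis.FluidPDE.HardSphereFreeStretch
import Literature.Analysis.FluidPDE.HardSphereTorusMeasure
import Literature.MathematicalPhysics.KineticTheory.HardSphereEulerProofs
import HarnessLib

/-!
# Weak readout at the instant `t` (crux `ChaosClosesEuler`, stmt-AtomisticToContinuum-15141, line `Sketch`,
# stub `stub_readout`) — helper 1: the pathwise time-modulus of the tested empirical fields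

WHAT. Along ONE good hard-sphere orbit `γ` on `𝕋³` (diameter `ε`, `n` spheres) the `χ`-tested empirical momentum
and energy observables `Σᵢ ⟪J(xᵢ), vᵢ⟫`, `Σᵢ b(xᵢ)‖vᵢ‖²/2` (`momentumObservable`, `energyObservable`) change
between two times `t ≤ s` by a TRANSPORT integral plus a COLLISION sum
(`IsHardSphereTrajectory.sub_eq_integral_add_collisionalTransfer`, the library's weak balance law). This file
bounds both pieces deterministically:

* transport: `|∫_t^s Σᵢ ⟪DJ(xᵢ)vᵢ, vᵢ⟫| ≤ ‖DJ‖_∞ · 2E · (s − t)` (energy conservation) and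
  `|∫_t^s Σᵢ (Db(xᵢ)vᵢ)‖vᵢ‖²/2| ≤ (‖Db‖_∞/2) ∫_t^s Σᵢ ‖vᵢ‖³` (the windowed CUBIC moment);
* collisions: at a binary collision of the pair `{p, q}` the jump is `⟪J(x_p) − J(x_q), v_p − v_p⁻⟫`
  resp. `(b(x_p) − b(x_q))(‖v_p‖² − ‖v_p⁻‖²)/2`; contact means `d(x_p, x_q) = ε`, so a Lipschitz weight pays
  `Lip · ε`, and the velocity factor is at most `1 + ‖v_p‖² + ‖v_q‖²` (pair energy conservation). Summing,
  the collision sum is at most `Lip · ε/2` times the WINDOWED QUADRATIC COLLISION FUNCTIONAL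
  `collisionPairSum G ε γ (t, s] (1 + ‖vᵢ‖² + ‖vⱼ‖²)` — the route's normalised functional
  `K_N[1 + |vᵢ|² + |vⱼ|²]` restricted to the window, before the factor `ε/(N+1)`
  (`collisionPairSum_eq_finsum_ite` is its inline form).

The density observable needs no balance law: positions are `‖v‖`-Lipschitz in time
(`stub_readoutModulus`, the registered sub-goal of this helper).

REFERENCES. H. Spohn, *Large Scale Dynamics of Interacting Particles* (1991), Part I (3.3)–(3.8) (microscopic
conservation laws with kinetic and collisional currents); R. Soto, *Kinetic Theory and Transport Phenomena* (2016)
§4.8.1 (collisional transfer). Everything below is proved from tree lemmas; no named fact is invoked.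
-/

noncomputable section

namespace Summit.AtomisticToContinuum.HydrodynamicLimit.Theorems.ChaosClosesEulerReadout

open scoped BigOperators Topology Classical MeasureTheory ENNReal InnerProductSpace
open Filter Set MeasureTheory
open Literature.MathematicalPhysics.KineticTheory
open Literature.Analysis.FluidPDE
open Literature.Analysis.FunctionSpaces

/-! ## §1 The quadratic contact-pair weight at one collision -/

section Trajectory

variable {n : ℕ} {ε : ℝ} {γ : ℝ → Config n (Fin 3) T3}

/-- The windowed quadratic collision functional is nonnegative. [folklore] -/
theorem collisionPairSum_quad_nonneg (ε : ℝ) (γ : ℝ → Config n (Fin 3) T3) (I : Set ℝ) :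
    0 ≤ collisionPairSum (Torus.geometry (Fin 3)) ε γ I (fun u i j => 1 + ‖(γ u i).2‖ ^ 2 + ‖(γ u j).2‖ ^ 2) :=
  finsum_nonneg fun u => finsum_nonneg fun _ => Finset.sum_nonneg fun p _ => by positivity

/-- At a collision time of a hard-sphere trajectory in the regular torus geometry the contact pairs are the colliding
pair `(p, q)` in its two orders, so the contact-pair sum of `1 + ‖vᵢ‖² + ‖vⱼ‖²` is `2 (1 + ‖v_p‖² + ‖v_q‖²)`.
[folklore] -/
theorem sum_contactPairs_quad_eq (hγ : IsHardSphereTrajectory (Torus.geometry (Fin 3)) ε n γ)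
    (hG : (Torus.geometry (Fin 3)).IsHardSphereRegular ε) {u : ℝ} {p q : Fin n}
    (hpq : (p, q) ∈ contactPairs (Torus.geometry (Fin 3)) ε (γ u)) :
    ∑ e ∈ contactPairs (Torus.geometry (Fin 3)) ε (γ u), (1 + ‖(γ u e.1).2‖ ^ 2 + ‖(γ u e.2).2‖ ^ 2) =
      2 * (1 + ‖(γ u p).2‖ ^ 2 + ‖(γ u q).2‖ ^ 2) := by
  have hne : p ≠ q := (mem_contactPairs.1 hpq).1
  have hne2 : ((p, q) : Fin n × Fin n) ≠ (q, p) := fun h => hne (Prod.mk.inj h).1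
  rw [hγ.contactPairs_eq_pair hG hpq, Finset.sum_pair hne2]
  ring

/-- Across a binary collision of `{p, q}` the velocity jump of `p` is at most `1 + ‖v_p‖² + ‖v_q‖²`
(post-collisional velocities; pair energy conservation bounds the pre-collisional speed). [folklore] -/
theorem norm_vel_sub_leftLim_le (hγ : IsHardSphereTrajectory (Torus.geometry (Fin 3)) ε n γ) {u : ℝ}
    {p q : Fin n} (hne : p ≠ q) (hc : γ u ∈ contactSet (Torus.geometry (Fin 3)) n ε p q) :
    ‖(γ u p).2 - (Function.leftLim γ u p).2‖ ≤ 1 + ‖(γ u p).2‖ ^ 2 + ‖(γ u q).2‖ ^ 2 := by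
  have hE := hγ.norm_sq_vel_add_eq_leftLim hne hc
  have h1 : ‖(Function.leftLim γ u p).2‖ ^ 2 ≤ ‖(γ u p).2‖ ^ 2 + ‖(γ u q).2‖ ^ 2 := by
    nlinarith [sq_nonneg ‖(Function.leftLim γ u q).2‖]
  calc ‖(γ u p).2 - (Function.leftLim γ u p).2‖ ≤ ‖(γ u p).2‖ + ‖(Function.leftLim γ u p).2‖ := norm_sub_le _ _
    _ ≤ 1 + ‖(γ u p).2‖ ^ 2 + ‖(γ u q).2‖ ^ 2 := by
        nlinarith [sq_nonneg (‖(γ u p).2‖ - 1), sq_nonneg (‖(Function.leftLim γ u p).2‖ - 1),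
          norm_nonneg (γ u p).2, norm_nonneg (Function.leftLim γ u p).2, sq_nonneg ‖(γ u q).2‖]

/-- Across a binary collision of `{p, q}` the kinetic-energy jump of `p` is at most `1 + ‖v_p‖² + ‖v_q‖²`.
[folklore] -/
theorem abs_norm_sq_sub_leftLim_le (hγ : IsHardSphereTrajectory (Torus.geometry (Fin 3)) ε n γ) {u : ℝ}
    {p q : Fin n} (hne : p ≠ q) (hc : γ u ∈ contactSet (Torus.geometry (Fin 3)) n ε p q) :
    |(‖(γ u p).2‖ ^ 2 - ‖(Function.leftLim γ u p).2‖ ^ 2) / 2| ≤ 1 + ‖(γ u p).2‖ ^ 2 + ‖(γ u q).2‖ ^ 2 := by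
  have hE := hγ.norm_sq_vel_add_eq_leftLim hne hc
  have h1 : ‖(Function.leftLim γ u p).2‖ ^ 2 ≤ ‖(γ u p).2‖ ^ 2 + ‖(γ u q).2‖ ^ 2 := by
    nlinarith [sq_nonneg ‖(Function.leftLim γ u q).2‖]
  rw [abs_le]
  constructor
  · nlinarith [sq_nonneg ‖(γ u p).2‖, sq_nonneg ‖(γ u q).2‖]
  · nlinarith [sq_nonneg ‖(γ u p).2‖, sq_nonneg ‖(γ u q).2‖, sq_nonneg ‖(Function.leftLim γ u p).2‖]

/-- **Collisional momentum transfer at one collision, bounded by the quadratic contact-pair weight.** For a test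
field `J` that is `LJ'`-Lipschitz in the minimal-image distance, at a collision time
`|⟪J(x_p) − J(x_q), v_p − v_p⁻⟫| ≤ (LJ' ε / 2) · Σ_{contact pairs} (1 + ‖vᵢ‖² + ‖vⱼ‖²)` (contact: `d(x_p, x_q) = ε`).
[folklore] -/
theorem abs_collisionJump_momentumObservable_le (hγ : IsHardSphereTrajectory (Torus.geometry (Fin 3)) ε n γ)
    (hG : (Torus.geometry (Fin 3)).IsHardSphereRegular ε) {J : T3 → V3} {LJ' : ℝ} (hLJ'0 : 0 ≤ LJ')
    (hLJ' : ∀ x y, ‖J x - J y‖ ≤ LJ' * Torus.euclidDist x y) {u : ℝ}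
    (hu : u ∈ collisionTimes (Torus.geometry (Fin 3)) ε γ) :
    |collisionJump (momentumObservable J) γ u| ≤
      LJ' * ε / 2 * ∑ e ∈ contactPairs (Torus.geometry (Fin 3)) ε (γ u), (1 + ‖(γ u e.1).2‖ ^ 2 + ‖(γ u e.2).2‖ ^ 2) := by
  obtain ⟨⟨p, q⟩, hpq⟩ := mem_collisionTimes_iff_contactPairs_nonempty.1 hu
  have hne : p ≠ q := (mem_contactPairs.1 hpq).1
  have hc : γ u ∈ contactSet (Torus.geometry (Fin 3)) n ε p q := (mem_contactPairs.1 hpq).2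
  have hdist : Torus.euclidDist (γ u p).1 (γ u q).1 = ε := by
    rw [← Torus.norm_geometry_sepVec]
    exact (mem_contactSet.1 hc).2
  have hε : 0 ≤ ε := hdist ▸ norm_nonneg _
  rw [hγ.collisionJump_momentumObservable Torus.continuous_geometry_translate J hne hc,
    sum_contactPairs_quad_eq hγ hG hpq]
  calc |⟪J (γ u p).1 - J (γ u q).1, (γ u p).2 - (Function.leftLim γ u p).2⟫_ℝ|
      ≤ ‖J (γ u p).1 - J (γ u q).1‖ * ‖(γ u p).2 - (Function.leftLim γ u p).2‖ := abs_real_inner_le_norm _ _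
    _ ≤ (LJ' * ε) * (1 + ‖(γ u p).2‖ ^ 2 + ‖(γ u q).2‖ ^ 2) :=
        mul_le_mul (by rw [← hdist]; exact hLJ' _ _) (norm_vel_sub_leftLim_le hγ hne hc) (norm_nonneg _)
          (mul_nonneg hLJ'0 hε)
    _ = LJ' * ε / 2 * (2 * (1 + ‖(γ u p).2‖ ^ 2 + ‖(γ u q).2‖ ^ 2)) := by ring

/-- **Collisional energy transfer at one collision, bounded by the quadratic contact-pair weight.** For a scalar
test `b` that is `Lb'`-Lipschitz in the minimal-image distance, at a collision time
`|(b(x_p) − b(x_q))(‖v_p‖² − ‖v_p⁻‖²)/2| ≤ (Lb' ε / 2) · Σ_{contact pairs} (1 + ‖vᵢ‖² + ‖vⱼ‖²)`. [folklore] -/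
theorem abs_collisionJump_energyObservable_le (hγ : IsHardSphereTrajectory (Torus.geometry (Fin 3)) ε n γ)
    (hG : (Torus.geometry (Fin 3)).IsHardSphereRegular ε) {b : T3 → ℝ} {Lb' : ℝ} (hLb'0 : 0 ≤ Lb')
    (hLb' : ∀ x y, |b x - b y| ≤ Lb' * Torus.euclidDist x y) {u : ℝ}
    (hu : u ∈ collisionTimes (Torus.geometry (Fin 3)) ε γ) :
    |collisionJump (energyObservable b) γ u| ≤
      Lb' * ε / 2 * ∑ e ∈ contactPairs (Torus.geometry (Fin 3)) ε (γ u), (1 + ‖(γ u e.1).2‖ ^ 2 + ‖(γ u e.2).2‖ ^ 2) := by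
  obtain ⟨⟨p, q⟩, hpq⟩ := mem_collisionTimes_iff_contactPairs_nonempty.1 hu
  have hne : p ≠ q := (mem_contactPairs.1 hpq).1
  have hc : γ u ∈ contactSet (Torus.geometry (Fin 3)) n ε p q := (mem_contactPairs.1 hpq).2
  have hdist : Torus.euclidDist (γ u p).1 (γ u q).1 = ε := by
    rw [← Torus.norm_geometry_sepVec]
    exact (mem_contactSet.1 hc).2
  have hε : 0 ≤ ε := hdist ▸ norm_nonneg _
  rw [hγ.collisionJump_energyObservable Torus.continuous_geometry_translate b hne hc,
    sum_contactPairs_quad_eq hγ hG hpq, abs_mul]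
  calc |b (γ u p).1 - b (γ u q).1| * |(‖(γ u p).2‖ ^ 2 - ‖(Function.leftLim γ u p).2‖ ^ 2) / 2|
      ≤ (Lb' * ε) * (1 + ‖(γ u p).2‖ ^ 2 + ‖(γ u q).2‖ ^ 2) :=
        mul_le_mul (by rw [← hdist]; exact hLb' _ _) (abs_norm_sq_sub_leftLim_le hγ hne hc) (abs_nonneg _)
          (mul_nonneg hLb'0 hε)
    _ = Lb' * ε / 2 * (2 * (1 + ‖(γ u p).2‖ ^ 2 + ‖(γ u q).2‖ ^ 2)) := by ring

end Trajectory

/-! ## §2 Streaming (transport) bounds -/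

/-- The streaming momentum flux against `J` is at most `‖DJ‖_∞ · 2E`. [folklore] -/
theorem abs_momentumStreaming_le {n : ℕ} {J : T3 → V3} {LJ : ℝ} (hLJ : ∀ x, ‖Torus.fderiv J x‖ ≤ LJ)
    (w : Config n (Fin 3) T3) : |momentumStreaming J w| ≤ LJ * (2 * configEnergy w) := by
  unfold momentumStreaming configEnergy
  calc |∑ i, ⟪Torus.fderiv J (w i).1 (w i).2, (w i).2⟫_ℝ|
      ≤ ∑ i, |⟪Torus.fderiv J (w i).1 (w i).2, (w i).2⟫_ℝ| := Finset.abs_sum_le_sum_abs _ _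
    _ ≤ ∑ i, LJ * ‖(w i).2‖ ^ 2 := Finset.sum_le_sum fun i _ => by
        calc |⟪Torus.fderiv J (w i).1 (w i).2, (w i).2⟫_ℝ|
            ≤ ‖Torus.fderiv J (w i).1 (w i).2‖ * ‖(w i).2‖ := abs_real_inner_le_norm _ _
          _ ≤ (LJ * ‖(w i).2‖) * ‖(w i).2‖ := by
              refine mul_le_mul_of_nonneg_right ?_ (norm_nonneg _)
              exact ((Torus.fderiv J (w i).1).le_opNorm _).trans
                (mul_le_mul_of_nonneg_right (hLJ _) (norm_nonneg _))
          _ = LJ * ‖(w i).2‖ ^ 2 := by ring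
    _ = LJ * (2 * (2⁻¹ * ∑ i, ‖(w i).2‖ ^ 2)) := by rw [← Finset.mul_sum]; ring

/-- The streaming energy flux against `b` is at most `(‖Db‖_∞/2) Σᵢ ‖vᵢ‖³`. [folklore] -/
theorem abs_energyStreaming_le {n : ℕ} {b : T3 → ℝ} {Lb : ℝ} (hLb : ∀ x, ‖Torus.fderiv b x‖ ≤ Lb)
    (w : Config n (Fin 3) T3) : |energyStreaming b w| ≤ Lb / 2 * ∑ i, ‖(w i).2‖ ^ 3 := by
  unfold energyStreaming
  calc |∑ i, Torus.fderiv b (w i).1 (w i).2 * (‖(w i).2‖ ^ 2 / 2)|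
      ≤ ∑ i, |Torus.fderiv b (w i).1 (w i).2 * (‖(w i).2‖ ^ 2 / 2)| := Finset.abs_sum_le_sum_abs _ _
    _ ≤ ∑ i, Lb / 2 * ‖(w i).2‖ ^ 3 := Finset.sum_le_sum fun i _ => by
        rw [abs_mul, abs_of_nonneg (by positivity : (0 : ℝ) ≤ ‖(w i).2‖ ^ 2 / 2)]
        have h1 : |Torus.fderiv b (w i).1 (w i).2| ≤ Lb * ‖(w i).2‖ := by
          rw [← Real.norm_eq_abs]
          exact ((Torus.fderiv b (w i).1).le_opNorm _).trans (mul_le_mul_of_nonneg_right (hLb _) (norm_nonneg _))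
        calc |Torus.fderiv b (w i).1 (w i).2| * (‖(w i).2‖ ^ 2 / 2) ≤ (Lb * ‖(w i).2‖) * (‖(w i).2‖ ^ 2 / 2) :=
              mul_le_mul_of_nonneg_right h1 (by positivity)
          _ = Lb / 2 * ‖(w i).2‖ ^ 3 := by ring
    _ = Lb / 2 * ∑ i, ‖(w i).2‖ ^ 3 := by rw [← Finset.mul_sum]

section Moduli

variable {n : ℕ} {ε : ℝ} {γ : ℝ → Config n (Fin 3) T3}

/-- Along a hard-sphere trajectory on `𝕋³`, every power of the speeds summed over the particles is interval
integrable in time (measurable, since the trajectory is; bounded, by energy conservation). [folklore] -/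
theorem intervalIntegrable_sum_norm_vel_pow (hγ : IsHardSphereTrajectory (Torus.geometry (Fin 3)) ε n γ)
    (m : ℕ) (a b : ℝ) : IntervalIntegrable (fun u => ∑ i, ‖(γ u i).2‖ ^ m) volume a b := by
  have hmeas : Measurable fun u => ∑ i, ‖(γ u i).2‖ ^ m := by
    have hc : Continuous fun w : Config n (Fin 3) T3 => ∑ i, ‖(w i).2‖ ^ m := by fun_prop
    exact hc.measurable.comp hγ.measurable_torus
  have hbound : ∀ u, ‖∑ i, ‖(γ u i).2‖ ^ m‖ ≤ (n : ℝ) * Real.sqrt (2 * configEnergy (γ a)) ^ m := by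
    intro u
    rw [Real.norm_eq_abs, abs_of_nonneg (Finset.sum_nonneg fun i _ => by positivity)]
    have hE : configEnergy (γ u) = configEnergy (γ a) := IsHardSphereTrajectory.configEnergy_eq_holds hγ u a
    calc ∑ i, ‖(γ u i).2‖ ^ m ≤ ∑ _i : Fin n, Real.sqrt (2 * configEnergy (γ a)) ^ m :=
          Finset.sum_le_sum fun i _ => by
            refine pow_le_pow_left₀ (norm_nonneg _) ?_ m
            rw [← hE, ← Real.sqrt_sq (norm_nonneg (γ u i).2)]
            exact Real.sqrt_le_sqrt (norm_vel_sq_le_two_mul_configEnergy (γ u) i)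
      _ = (n : ℝ) * Real.sqrt (2 * configEnergy (γ a)) ^ m := by
          rw [Finset.sum_const, Finset.card_univ, Fintype.card_fin, nsmul_eq_mul]
  refine (Measure.integrableOn_of_bounded ?_ hmeas.aestronglyMeasurable (ae_of_all _ hbound)).intervalIntegrable
  rw [Real.volume_interval]
  exact ENNReal.ofReal_ne_top

/-- **Time modulus of the tested momentum observable.** For a `C¹` test field `J` with `‖DJ‖ ≤ LJ` and
`LJ'`-Lipschitz in the minimal-image distance, along a hard-sphere trajectory and `t ≤ s`:
`|Σᵢ⟪J(xᵢ(s)),vᵢ(s)⟫ − Σᵢ⟪J(xᵢ(t)),vᵢ(t)⟫| ≤ LJ · 2E · (s − t) + (LJ' ε/2) · Σ_{coll ∈ (t,s]} Σ_{contact} (1 + ‖vᵢ‖² + ‖vⱼ‖²)`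
(weak momentum balance: streaming bounded by the conserved energy, collisions by
`abs_collisionJump_momentumObservable_le`). [folklore] -/
theorem abs_momentumObservable_sub_le (hγ : IsHardSphereTrajectory (Torus.geometry (Fin 3)) ε n γ)
    (hG : (Torus.geometry (Fin 3)).IsHardSphereRegular ε) {J : T3 → V3} (hJ : Torus.IsContDiff 1 J)
    {LJ LJ' : ℝ} (hLJ : ∀ x, ‖Torus.fderiv J x‖ ≤ LJ) (hLJ'0 : 0 ≤ LJ')
    (hLJ' : ∀ x y, ‖J x - J y‖ ≤ LJ' * Torus.euclidDist x y) {t s : ℝ} (hts : t ≤ s) :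
    |momentumObservable J (γ s) - momentumObservable J (γ t)| ≤
      LJ * (2 * configEnergy (γ t)) * (s - t) + LJ' * ε / 2 *
        collisionPairSum (Torus.geometry (Fin 3)) ε γ (Set.Ioc t s) (fun u i j => 1 + ‖(γ u i).2‖ ^ 2 + ‖(γ u j).2‖ ^ 2) := by
  obtain ⟨-, heq⟩ := hγ.sub_eq_integral_add_collisionalTransfer Torus.continuous_geometry_translate
    (hasDerivAt_momentumObservable_freeFlight hJ)
    (fun z => (continuous_momentumStreaming hJ).comp
      (continuous_freeFlight_of_continuous_translate Torus.continuous_geometry_translate z)) hts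
  rw [heq]
  refine (abs_add_le _ _).trans (add_le_add ?_ ?_)
  · have hE : ∀ u, configEnergy (γ u) = configEnergy (γ t) := fun u =>
      IsHardSphereTrajectory.configEnergy_eq_holds hγ u t
    have hbound : ∀ u ∈ Set.uIoc t s, ‖momentumStreaming J (γ u)‖ ≤ LJ * (2 * configEnergy (γ t)) := fun u _ => by
      rw [Real.norm_eq_abs, ← hE u]
      exact abs_momentumStreaming_le hLJ _
    have h := intervalIntegral.norm_integral_le_of_norm_le_const hbound
    rwa [Real.norm_eq_abs, abs_of_nonneg (sub_nonneg.2 hts)] at h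
  · unfold collisionalTransfer
    have hfin := hγ.finite_collisionTimes_inter_Ioc t s
    rw [collisionPairSum_eq_finset_sum hfin, finsum_mem_eq_finite_toFinset_sum _ hfin, Finset.mul_sum]
    refine (Finset.abs_sum_le_sum_abs _ _).trans (Finset.sum_le_sum fun u hu => ?_)
    exact abs_collisionJump_momentumObservable_le hγ hG hLJ'0 hLJ' (hfin.mem_toFinset.1 hu).1

/-- **Time modulus of the tested energy observable.** For a `C¹` scalar test `b` with `‖Db‖ ≤ Lb` and
`Lb'`-Lipschitz in the minimal-image distance, along a hard-sphere trajectory and `t ≤ s`: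
`|Σᵢ b(xᵢ(s))‖vᵢ(s)‖²/2 − Σᵢ b(xᵢ(t))‖vᵢ(t)‖²/2| ≤ (Lb/2) ∫_t^s Σᵢ‖vᵢ‖³ + (Lb' ε/2) · Σ_{coll ∈ (t,s]} Σ_{contact} (1 + ‖vᵢ‖² + ‖vⱼ‖²)`
(weak energy balance: streaming bounded by the windowed cubic moment, collisions by
`abs_collisionJump_energyObservable_le`). [folklore] -/
theorem abs_energyObservable_sub_le (hγ : IsHardSphereTrajectory (Torus.geometry (Fin 3)) ε n γ)
    (hG : (Torus.geometry (Fin 3)).IsHardSphereRegular ε) {b : T3 → ℝ} (hb : Torus.IsContDiff 1 b)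
    {Lb Lb' : ℝ} (hLb : ∀ x, ‖Torus.fderiv b x‖ ≤ Lb) (hLb'0 : 0 ≤ Lb')
    (hLb' : ∀ x y, |b x - b y| ≤ Lb' * Torus.euclidDist x y) {t s : ℝ} (hts : t ≤ s) :
    |energyObservable b (γ s) - energyObservable b (γ t)| ≤
      Lb / 2 * (∫ u in t..s, ∑ i, ‖(γ u i).2‖ ^ 3) + Lb' * ε / 2 *
        collisionPairSum (Torus.geometry (Fin 3)) ε γ (Set.Ioc t s) (fun u i j => 1 + ‖(γ u i).2‖ ^ 2 + ‖(γ u j).2‖ ^ 2) := by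
  obtain ⟨hint, heq⟩ := hγ.sub_eq_integral_add_collisionalTransfer Torus.continuous_geometry_translate
    (hasDerivAt_energyObservable_freeFlight hb)
    (fun z => (continuous_energyStreaming hb).comp
      (continuous_freeFlight_of_continuous_translate Torus.continuous_geometry_translate z)) hts
  rw [heq]
  refine (abs_add_le _ _).trans (add_le_add ?_ ?_)
  · have hcub := intervalIntegrable_sum_norm_vel_pow hγ 3 t s
    calc |∫ u in t..s, energyStreaming b (γ u)| ≤ ∫ u in t..s, |energyStreaming b (γ u)| :=
          intervalIntegral.abs_integral_le_integral_abs hts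
      _ ≤ ∫ u in t..s, Lb / 2 * ∑ i, ‖(γ u i).2‖ ^ 3 :=
          intervalIntegral.integral_mono_on hts hint.abs (hcub.const_mul _) fun u _ => abs_energyStreaming_le hLb _
      _ = Lb / 2 * ∫ u in t..s, ∑ i, ‖(γ u i).2‖ ^ 3 := intervalIntegral.integral_const_mul _ _
  · unfold collisionalTransfer
    have hfin := hγ.finite_collisionTimes_inter_Ioc t s
    rw [collisionPairSum_eq_finset_sum hfin, finsum_mem_eq_finite_toFinset_sum _ hfin, Finset.mul_sum]
    refine (Finset.abs_sum_le_sum_abs _ _).trans (Finset.sum_le_sum fun u hu => ?_)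
    exact abs_collisionJump_energyObservable_le hγ hG hLb'0 hLb' (hfin.mem_toFinset.1 hu).1

/-- The windowed quadratic collision functional is monotone in the window. [folklore] -/
theorem collisionPairSum_quad_mono (hγ : IsHardSphereTrajectory (Torus.geometry (Fin 3)) ε n γ) {I J : Set ℝ}
    (hIJ : I ⊆ J) {a b : ℝ} (hJ : J ⊆ Set.Icc a b) :
    collisionPairSum (Torus.geometry (Fin 3)) ε γ I (fun u i j => 1 + ‖(γ u i).2‖ ^ 2 + ‖(γ u j).2‖ ^ 2) ≤
      collisionPairSum (Torus.geometry (Fin 3)) ε γ J (fun u i j => 1 + ‖(γ u i).2‖ ^ 2 + ‖(γ u j).2‖ ^ 2) := by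
  have hfinJ : (collisionTimes (Torus.geometry (Fin 3)) ε γ ∩ J).Finite :=
    (hγ.locFinite a b).subset (Set.inter_subset_inter_right _ hJ)
  have hfinI : (collisionTimes (Torus.geometry (Fin 3)) ε γ ∩ I).Finite :=
    hfinJ.subset (Set.inter_subset_inter_right _ hIJ)
  rw [collisionPairSum_eq_finset_sum hfinI, collisionPairSum_eq_finset_sum hfinJ]
  exact Finset.sum_le_sum_of_subset_of_nonneg
    (Set.Finite.toFinset_subset_toFinset.2 (Set.inter_subset_inter_right _ hIJ))
    fun u _ _ => Finset.sum_nonneg fun p _ => by positivity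

end Moduli

/-! ## §3 The density observable: Lipschitz in the positions -/

/-- **Registered sub-goal `stub_readoutModulus` (helper 1 of `stub_readout`).** A Lipschitz (in the minimal-image
distance) weight summed over the particles changes by at most `L` times the total displacement — the density
observable's time modulus needs no balance law. [folklore] -/
theorem stub_readoutModulus : ∀ {n : ℕ} {b : T3 → ℝ} {L : ℝ}, (∀ x y, |b x - b y| ≤ L * Torus.euclidDist x y) → ∀ w w' : Config n (Fin 3) T3, |∑ i, b (w' i).1 - ∑ i, b (w i).1| ≤ L * ∑ i, Torus.euclidDist (w' i).1 (w i).1 := by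
  intro n b L hLb' w w'
  rw [← Finset.sum_sub_distrib, Finset.mul_sum]
  exact (Finset.abs_sum_le_sum_abs _ _).trans (Finset.sum_le_sum fun i _ => hLb' _ _)

end Summit.AtomisticToContinuum.HydrodynamicLimit.Theorems.ChaosClosesEulerReadout

end
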